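import Mathlib
import Summits.Ventures.PercRepro2.K5HyperCoeffs3
import Summits.Ventures.PercRepro2.K5HyperTheoremI
import Summits.Ventures.PercRepro2.K5TypedK3

/-!
# THE CRUX KERNEL'S STAR STATEMENTS AS PROFILE SUMS OF `K₃` ON `K₅`
(blind cell PercRepro2, typer-1 g10; mine-1 §23.12 — the dictionary between `K5HyperCoeffs3.lean` and the
(TRI) kernel `CovForm.K3`)

`NOn3 S₁ S₂ S₃ k = Σ_{prof x y w = k} K₃(x ∨ S₁, y ∨ S₂, w ∨ S₃)` is the hyperedge-augmented typed count
(`typedCountHyper`) of the crux kernel at the `K₅` profile `k`; `NOn3_eq`: it is `cPosOn3 − cNegOn3`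
(`K5K3Tables.K3_apply`).  With the placement sums `rsumT1`, …:

* **`M3_real`**: `N(K₅ + D(1)) ≤ N(K₅ + D(1) + P(1))` — `M-TRI ≥ 0`;
* **`TvT3_real`**: `N(K₅ + T(1)) ≤ N(K₅ + △(1,1,1))` — `TvT-TRI ≥ 0`;
* **`T13_real`**, **`T23_real`**: `0 ≤ N(K₅ + D(1))`, `0 ≤ N(K₅ + D(2))`.
-/

namespace Summit.Ventures.PercRepro2

open Hub

namespace K5

section Dictionary3

variable {R : Type*} [Field R] [LinearOrder R] [IsStrictOrderedRing R]

/-- The masked profile sum of the crux kernel `K₃` at the marks `(0, 1, 2, 3, 4)`. -/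
noncomputable def NOn3 (S₁ S₂ S₃ : Fin 10 → Bool) (k : Fin 10 → Fin 4) : R :=
  typedCountHyper Finset.univ (fun _ => false) (fun e => (k e : ℕ)) S₁ S₂ S₃
    (CovForm.K3 (R := R) ends5 0 1 2 3 4)

/-- `N(K₅ + D(1))`. -/
noncomputable def NT13 (D : Fin 10 → Bool) (k : Fin 10 → Fin 4) : R := rsumT1 (fun S₁ S₂ S₃ => NOn3 S₁ S₂ S₃ k) D

/-- `N(K₅ + D(2))`. -/
noncomputable def NT23 (D : Fin 10 → Bool) (k : Fin 10 → Fin 4) : R := rsumT2 (fun S₁ S₂ S₃ => NOn3 S₁ S₂ S₃ k) D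

/-- `N(K₅ + D(1) + P(1))`. -/
noncomputable def NT1e13 (D P : Fin 10 → Bool) (k : Fin 10 → Fin 4) : R :=
  rsumT1e1 (fun S₁ S₂ S₃ => NOn3 S₁ S₂ S₃ k) D P

/-- `N(K₅ + P₁(1) + P₂(1) + P₃(1))`. -/
noncomputable def NE33 (P₁ P₂ P₃ : Fin 10 → Bool) (k : Fin 10 → Fin 4) : R :=
  rsumE3 (fun S₁ S₂ S₃ => NOn3 S₁ S₂ S₃ k) P₁ P₂ P₃

/-- `((4 : Fin 5) : ℕ) = 4`. -/
lemma val4 : ((4 : Fin 5) : ℕ) = 4 := rfl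

set_option maxHeartbeats 4000000 in
omit [LinearOrder R] [IsStrictOrderedRing R] in
/-- **The dictionary**: the masked profile sum of `K₃` is `cPosOn3 − cNegOn3`. -/
theorem NOn3_eq (S₁ S₂ S₃ : Fin 10 → Bool) (k : Fin 10 → Fin 4) :
    NOn3 (R := R) S₁ S₂ S₃ k = ((cPosOn3 S₁ S₂ S₃ k : ℕ) : R) - ((cNegOn3 S₁ S₂ S₃ k : ℕ) : R) := by
  unfold NOn3 typedCountHyper
  have hK : (fun x y w => CovForm.K3 (R := R) ends5 0 1 2 3 4 (orOn S₁ x) (orOn S₂ y) (orOn S₃ w)) =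
      fun x y w =>
        (indR (fun ω => tPD (orOn S₁ ω)) x * indR (fun ω => tQ (orOn S₂ ω)) y * indR (fun ω => t4p 4 (orOn S₃ ω)) w +
          indR (fun ω => tQ (orOn S₁ ω)) x * indR (fun ω => tPDoU (orOn S₂ ω)) y * indR (fun ω => t5p 4 (orOn S₃ ω)) w +
          indR (fun ω => tPD (orOn S₁ ω)) x * indR (fun ω => tQ (orOn S₂ ω)) y * indR (fun ω => t6m 4 (orOn S₃ ω)) w +
          indR (fun ω => tPD (orOn S₁ ω)) x * indR (fun ω => t7p 4 (orOn S₂ ω)) y * indR (fun ω => t7m 0 (orOn S₃ ω)) w +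
          indR (fun ω => tPD (orOn S₁ ω)) x * indR (fun ω => t7m 4 (orOn S₂ ω)) y * indR (fun ω => t7p 0 (orOn S₃ ω)) w +
          indR (fun ω => tPDoU (orOn S₁ ω)) x * indR (fun ω => t7p 4 (orOn S₂ ω)) y * indR (fun ω => t7m 3 (orOn S₃ ω)) w +
          indR (fun ω => tPDoU (orOn S₁ ω)) x * indR (fun ω => t7m 4 (orOn S₂ ω)) y * indR (fun ω => t7p 3 (orOn S₃ ω)) w +
          indR (fun ω => tPD (orOn S₁ ω)) x * indR (fun ω => t7p 4 (orOn S₂ ω)) y * indR (fun ω => t10p (orOn S₃ ω)) w +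
          indR (fun ω => tPD (orOn S₁ ω)) x * indR (fun ω => t7m 4 (orOn S₂ ω)) y * indR (fun ω => t10m (orOn S₃ ω)) w +
          indR (fun ω => tQ (orOn S₁ ω)) x * indR (fun ω => t12 4 (orOn S₂ ω)) y * indR (fun ω => tPDoU (orOn S₃ ω)) w) -
        (indR (fun ω => tPD (orOn S₁ ω)) x * indR (fun ω => tQ (orOn S₂ ω)) y * indR (fun ω => t4m 4 (orOn S₃ ω)) w +
          indR (fun ω => tQ (orOn S₁ ω)) x * indR (fun ω => tPDoU (orOn S₂ ω)) y * indR (fun ω => t5m 4 (orOn S₃ ω)) w +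
          indR (fun ω => tPD (orOn S₁ ω)) x * indR (fun ω => tQ (orOn S₂ ω)) y * indR (fun ω => t6p 4 (orOn S₃ ω)) w +
          indR (fun ω => tPD (orOn S₁ ω)) x * indR (fun ω => t7p 4 (orOn S₂ ω)) y * indR (fun ω => t7p 0 (orOn S₃ ω)) w +
          indR (fun ω => tPD (orOn S₁ ω)) x * indR (fun ω => t7m 4 (orOn S₂ ω)) y * indR (fun ω => t7m 0 (orOn S₃ ω)) w +
          indR (fun ω => tPDoU (orOn S₁ ω)) x * indR (fun ω => t7p 4 (orOn S₂ ω)) y * indR (fun ω => t7p 3 (orOn S₃ ω)) w +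
          indR (fun ω => tPDoU (orOn S₁ ω)) x * indR (fun ω => t7m 4 (orOn S₂ ω)) y * indR (fun ω => t7m 3 (orOn S₃ ω)) w +
          indR (fun ω => tPD (orOn S₁ ω)) x * indR (fun ω => t7p 4 (orOn S₂ ω)) y * indR (fun ω => t10m (orOn S₃ ω)) w +
          indR (fun ω => tPD (orOn S₁ ω)) x * indR (fun ω => t7m 4 (orOn S₂ ω)) y * indR (fun ω => t10p (orOn S₃ ω)) w +
          indR (fun ω => tPD (orOn S₁ ω)) x * indR (fun ω => tQ (orOn S₂ ω)) y * indR (fun ω => t11 4 (orOn S₃ ω)) w) := by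
    funext x y w
    rw [K3_apply (4 : Fin 5)]
    simp only [indR, val4]
    ring
  rw [hK, typedCount_sub]
  simp only [typedCount_add, typedCount_tables Finset.univ (fun _ => false) (fun e => (k e : ℕ)) k (profile_univ k)]
  unfold cPosOn3 cNegOn3 cOn
  push_cast
  ring

omit [LinearOrder R] [IsStrictOrderedRing R] in
/-- `N(K₅ + D(1)) = csumT1 cPosOn3 − csumT1 cNegOn3`. -/
lemma NT13_eq (D : Fin 10 → Bool) (k : Fin 10 → Fin 4) :
    NT13 (R := R) D k = ((csumT1 cPosOn3 D k : ℕ) : R) - ((csumT1 cNegOn3 D k : ℕ) : R) := by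
  unfold NT13 rsumT1 csumT1
  simp only [NOn3_eq]
  push_cast
  ring

omit [LinearOrder R] [IsStrictOrderedRing R] in
/-- `N(K₅ + D(2)) = csumT2 cPosOn3 − csumT2 cNegOn3`. -/
lemma NT23_eq (D : Fin 10 → Bool) (k : Fin 10 → Fin 4) :
    NT23 (R := R) D k = ((csumT2 cPosOn3 D k : ℕ) : R) - ((csumT2 cNegOn3 D k : ℕ) : R) := by
  unfold NT23 rsumT2 csumT2
  simp only [NOn3_eq]
  push_cast
  ring

omit [LinearOrder R] [IsStrictOrderedRing R] in
/-- `N(K₅ + D(1) + P(1)) = csumT1e1 cPosOn3 − csumT1e1 cNegOn3`. -/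
lemma NT1e13_eq (D P : Fin 10 → Bool) (k : Fin 10 → Fin 4) :
    NT1e13 (R := R) D P k = ((csumT1e1 cPosOn3 D P k : ℕ) : R) - ((csumT1e1 cNegOn3 D P k : ℕ) : R) := by
  unfold NT1e13 rsumT1e1 csumT1e1
  simp only [NOn3_eq]
  push_cast
  ring

omit [LinearOrder R] [IsStrictOrderedRing R] in
/-- `N(K₅ + P₁(1) + P₂(1) + P₃(1)) = csumE3 cPosOn3 − csumE3 cNegOn3`. -/
lemma NE33_eq (P₁ P₂ P₃ : Fin 10 → Bool) (k : Fin 10 → Fin 4) :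
    NE33 (R := R) P₁ P₂ P₃ k = ((csumE3 cPosOn3 P₁ P₂ P₃ k : ℕ) : R) - ((csumE3 cNegOn3 P₁ P₂ P₃ k : ℕ) : R) := by
  unfold NE33 rsumE3 csumE3 csumE3a csumE3b csumE3c
  simp only [NOn3_eq]
  push_cast
  ring

/-- **`M-TRI ≥ 0`: `N(K₅ + D(1)) ≤ N(K₅ + D(1) + P(1))`** from the certificate. -/
theorem M3_real (D P : Fin 10 → Bool) (hc : CertLE (kNegM3 D P) (kPosM3 D P)) (k : Fin 10 → Fin 4) :
    NT13 (R := R) D k ≤ NT1e13 (R := R) D P k := by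
  have h := cNegM3_le_cPosM3 D P hc k
  unfold cNegM3 cPosM3 at h
  rw [NT13_eq, NT1e13_eq, sub_le_sub_iff]
  exact_mod_cast (by omega :
    csumT1 cPosOn3 D k + csumT1e1 cNegOn3 D P k ≤ csumT1e1 cPosOn3 D P k + csumT1 cNegOn3 D k)

/-- **`TvT-TRI ≥ 0`: `N(K₅ + T(1)) ≤ N(K₅ + △(1,1,1))`** from the base-`2^25` certificate. -/
theorem TvT3_real (a b c : ℕ) (hc : CertLE5 (kNegTvT35 a b c) (kPosTvT35 a b c)) (k : Fin 10 → Fin 4) :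
    NT13 (R := R) (triMask a b c) k ≤ NE33 (R := R) (pairMask a b) (pairMask a c) (pairMask b c) k := by
  have h := cNegTvT3_le_cPosTvT3 a b c hc k
  unfold cNegTvT3 cPosTvT3 at h
  rw [NT13_eq, NE33_eq, sub_le_sub_iff]
  exact_mod_cast (by omega :
    csumT1 cPosOn3 (triMask a b c) k + csumE3 cNegOn3 (pairMask a b) (pairMask a c) (pairMask b c) k ≤
      csumE3 cPosOn3 (pairMask a b) (pairMask a c) (pairMask b c) k + csumT1 cNegOn3 (triMask a b c) k)

/-- **`0 ≤ N(K₅ + D(1))`** from the certificate. -/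
theorem T13_real (D : Fin 10 → Bool) (hc : CertLE (sumT1 negOn3 D) (sumT1 posOn3 D)) (k : Fin 10 → Fin 4) :
    0 ≤ NT13 (R := R) D k := by
  rw [NT13_eq, sub_nonneg]
  exact_mod_cast cT13_le D hc k

/-- **`0 ≤ N(K₅ + D(2))`** from the certificate. -/
theorem T23_real (D : Fin 10 → Bool) (hc : CertLE (sumT2 negOn3 D) (sumT2 posOn3 D)) (k : Fin 10 → Fin 4) :
    0 ≤ NT23 (R := R) D k := by
  rw [NT23_eq, sub_nonneg]
  exact_mod_cast cT23_le D hc k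

end Dictionary3

end K5

end Summit.Ventures.PercRepro2
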